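import Mathlib
import Literature.MathematicalPhysics.QuantumFieldTheory.MagnenRivasseauSeneor1993.MRS93CountertermFunctional
import HarnessLib

/-!
# Magnen–Rivasseau–Sénéor (CMP 155, 1993), Sect. IV p.352, the well-definedness paragraph after the starting point
# (IV.1): «for large fields A′ the leading terms are the F₄ term and the (A′)⁴ term in CT_ρ, which are respectively
# positive and positive definite» — KERNEL-CHECKED on every finite momentum window: the (A′)⁴ counterterm of (III.1)
# (a_ρ > 0, Lemma III.1) dominates EVERY quadratic exponential of the cut-off field, so that the positive Gaussian
# factor of (II.18)/(II.78) — by itself NOT `dμ_{0,ρ₁}`-integrable («This formula is still formal», p.332, a theorem of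
# `…MRS93AxialYMAction` §7) — becomes an integrable density once multiplied by `e^{CT_ρ}`

statement-level skeleton of a published sentence with citation tags; the finite-dimensional estimate proved; nothing
here is a claim about the Yang–Mills mass gap, about continuum Yang–Mills on `T⁴` without infrared cutoff, or about
the Clay problem — and nothing of Magnen–Rivasseau–Sénéor's expansion or estimates is asserted or formalised

**Citation header (reproduction of PUBLISHED work).** J. Magnen, V. Rivasseau, R. Sénéor, *Construction of YM₄ with
an infrared cutoff*, Commun. Math. Phys. **155** (1993) 325–383 [MagnenRivasseauSeneor1993], Sect. IV p.352 tl.26–33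
(the paragraph after (IV.1)); Sect. III (III.1) p.347 tl.28–35, Lemma III.1 (III.2) p.348 tl.5–8; Sect. II.A
(II.16)–(II.18) p.332 tl.3–26. Loci `p.NNN tl.nn` = journal page / text-layer line of the held scan
`paper:magnen1993-cmp155-mrs-ym4-infrared-cutoff` (PDF page = journal page − 324); the p.352 paragraph re-read on the
decoded 600 dpi page image (render of record `run/shared/lean/pub/lit-balaban/inprint/lit-balaban-p14/renders-cmp155/
p28_full_s6.png`; 2× crop `run/shared/lean/pub/pub-balaban-gaps/pub-balaban-gaps-mrs-lit-1/g10/renders/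
p28_crop_r2900-4900_s2.png`). Cell pub-balaban-gaps (YM blitz, track G3 «MRS 1993 typed AS PRINTED as the independent
second ultraviolet route»), seat mrs-lit-1 (gen 10); companion prose `run/shared/lean/pub/pub-balaban-gaps/g3/
MRS-AS-PRINTED.md` §2, §5. Builds BY NAME, re-declaring nothing, on `…MRS93CountertermFunctional` (gen 5: the four
operators of (III.1) `MainStatement.opA2`/`opALapA`/`opDivSq`/`opA4` on a momentum window, `counterterm` = CT_ρ,
`ctFactor` = e^{CT_ρ}, **`opA2_sq_le_opA4`** = «(∫_Λ A²)² ≤ ∫_Λ A⁴» for real fields on symmetric windows,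
`coeff_realify_neg`, `continuous_ctFactor`), on `…MRS93AxialYMAction` (gen 3: `quadForm` = ⟨A, w(p)A⟩, `F4_nonneg`,
`quadSlices` = Σ_{i≤ρ₁}(λ_i^t)²⟨A, p²κ^i(p)A⟩ with `quadSlices_eq_invC0`, and the NON-integrability theorem
`not_integrable_exp_half_quadSlices_muZero` of p.332 tl.24–26) and on `…MRS93GaussianReferenceMeasures` (gen 2:
`gaussianFieldLaw`, `realify`, `muZero` = dμ_{0,ρ₁}(A), `muZeroPrime` = dμ_{0,ρ₁}(A′)dμ_{C₀,ρ₁}(A′₀)).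

**What the paper prints (verbatim, from the page images).**
* p.352 tl.26–33 (after the display (IV.1) = the bare ansatz (II.78) recalled, «Let us recall our starting point:»):
  *«This starting point is clearly well defined because we have both finite volume and ultraviolet cutoff on each of
  the fields involved. Hence the sample fields are smooth. Furthermore for large fields A′ the leading terms are the
  F₄ term and the (A′)⁴ term in CT_ρ, which are respectively positive and positive definite. The γ integrals are
  also convergent at large γ thanks to the protecting term in γ¹⁰⁰. Remark however that it is only for fields of
  order λ⁻¹ that the (A′)⁴ term provides convergence, so this term alone does not confine the field in the true
  perturbative region (A′ ≪ λ⁻¹). It is only the combination of this term with the axial gauge positivity which does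
  this.»*
* (III.1) p.347 tl.33–35: *«Therefore the counterterms that we introduce are: e^{CT} = e^{−a_ρ∫_Λ(A⁴/4!) −
  b_ρ∫_Λ(A²/2!) − c_ρ∫_Λ(A(−Δ)A) − d_ρ∫_Λ(∂A)² − e_ρ∫_Λ F₄}. (III.1)»*; Lemma III.1 p.348 tl.5–8: *«a_ρ ≅ aλ_ρ⁴, b_ρ ≅
  bM^{2ρ}λ_ρ², c_ρ ≅ cλ_ρ², d_ρ ≅ dλ_ρ², e_ρ ≅ eλ_ρ⁴. (III.2) Furthermore by choosing the cutoff of the form (II.14)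
  with η small enough (depending on the shape of τ), the coefficient a is strictly positive.»*
* p.332 tl.16–26 (as quoted in `…MRS93AxialYMAction`): (II.18) *«dμ_{ax} = dμ_{0,ρ₁}(A) e^{+(1/2)Σ_i(λ_i^t)²⟨A,
  p²κ^i(p)A⟩} … This formula is still formal … since the second would give back the ill-defined Lebesgue measure»*.

**What is typed here (the estimate kernel-checked; zero `sorry`, zero named facts).** On a finite momentum window
`S` (READING (P) of gens 3–5: cut-off configurations `Config`, ⟨A, w(p)A⟩ = `quadForm S w A`, ∫_Λ A² = `opA2 S A`):
* §1 the one-line calculus fact `neg_mul_sq_add_mul_le` (`−αt² + ct ≤ c²/(4α)` for `α > 0`) and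
  `counterterm_le_neg_opA4` (with `b_ρ, c_ρ, d_ρ, e_ρ ≥ 0` — signs not printed, hypotheses as in gen 5 —
  `CT_ρ(A) ≤ −(a_ρ/24)∫_Λ A⁴`: the other four operators are `≥ 0`, in particular «the F₄ term … positive»,
  `F4_nonneg`).
* §2 **«the (A′)⁴ term in CT_ρ … positive definite» ⟹ DOMINATION OF EVERY QUADRATIC EXPONENTIAL**, for REAL
  configurations (`Ã(−p) = conj Ã(p)`) on a SYMMETRIC window and `a_ρ > 0`: `ctFactor_le_exp_neg_sq` (`e^{CT_ρ(A)} ≤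
  e^{−(a_ρ/24)(∫_Λ A²)²}` — Gaussian-beating decay, by gen 5's `(∫A²)² ≤ ∫A⁴`), **`counterterm_add_mul_opA2_le`**
  (`CT_ρ(A) + c∫_Λ A² ≤ 6c²/a_ρ` for EVERY real `c`), **`ctFactor_mul_exp_le`** (`e^{CT_ρ(A)}·e^{c∫_Λ A²} ≤
  e^{6c²/a_ρ}`), `ctFactor_mul_exp_le_of_growth` (any factor with `g(A) ≤ c∫_Λ A² + c'` is tamed: `e^{CT_ρ}·e^{g} ≤
  e^{6c²/a_ρ + c'}`), `quadForm_le_mul_opA2` (`⟨A, w(p)A⟩ ≤ W·∫_Λ A²` whenever `w ≤ W` on the window), `symBound`/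
  `le_symBound` (every symbol is bounded on a finite window), **`ctFactor_mul_exp_quadForm_le`** (`e^{CT_ρ(A)}·e^{⟨A,
  w(p)A⟩} ≤ e^{6W²/a_ρ}`), `ctFactor_mul_exp_quadForm_le_realify` (the same for the realified coordinates the
  tree's Gaussian laws live on).
* §3 **THE CONTRAST WITH p.332 MADE A THEOREM.** `half_quadSlices_le`; **`ctFactor_mul_exp_half_quadSlices_le`**
  (`e^{CT_ρ(A)}·e^{+(1/2)Σ_{i≤ρ₁}(λ_i^t)²⟨A, p²κ^i(p)A⟩} ≤ e^{6(W/2)²/a_ρ}`, `W = symBound` of the symbol `C₀⁻¹(p)` of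
  (II.16)); `integrable_ctFactor_mul_exp_gaussianFieldLaw` (a bounded continuous `e^{CT_ρ}·e^{g}` is integrable against
  every realified Gaussian field law of the tree); **`integrable_ctFactor_mul_exp_half_quadSlices_muZero`**: for every
  window symmetric under `p ↦ −p`, every `ρ, ρ₁`, every counterterm family with `a_ρ > 0` and `b_ρ, c_ρ, d_ρ, e_ρ ≥
  0`, the function `A ↦ e^{CT_ρ(A)}·e^{(1/2)Σ_{i≤ρ₁}(λ_i^t)²⟨A, p²κ^i(p)A⟩}` IS `dμ_{0,ρ₁}`-integrable — whereas WITHOUT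
  `e^{CT_ρ}` the second factor alone is NOT (`MainStatement.not_integrable_exp_half_quadSlices_muZero`, gen 3, p.332
  «still formal»); `integrable_ctFactor_mul_exp_quadForm_muZeroPrime` (the same against the twelve-component
  reference measure `dμ_{0,ρ₁}(A′)dμ_{C₀,ρ₁}(A′₀)` of (II.44)–(II.46), for any bounded symbol).
* §3b **«It is only the combination of this term with the axial gauge positivity which does this.»** With gen 3's
  positivity `ymFactor_le_exp_half_quadSlices` («both pieces in (II.9) are obviously positive»):
  `ctFactor_mul_ymFactor_le`, `integrable_ctFactor_mul_of_le_gaussianFieldLaw`,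
  **`integrable_ctFactor_mul_ymFactor_muZero`** (the FULL third factor of (II.78)/(IV.1),
  `e^{(1/2)(−F²_sp(A) − ⟨A,p₀²A⟩ + Σ_{i≤ρ₁}(λ_i^t)²⟨A,p²κ^i(p)A⟩)}` = gen 3's `MainStatement.ymFactor`, times `e^{CT_ρ(A)}` is
  `dμ_{0,ρ₁}`-integrable for every coupling, window, `ρ, ρ₁`), and
  **`isFiniteMeasure_muZero_withDensity_ctFactor_mul_ymFactor`**: `dμ_{0,ρ₁}·e^{CT_ρ}·(third factor)` IS A FINITE
  MEASURE on every symmetric window — the formula (II.18), «still formal» alone, is no longer formal once the (II.78)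
  counterterm factor with `a_ρ > 0` multiplies it (in one common variable, READING (V1)).
* §4 «only for fields of order λ⁻¹ that the (A′)⁴ term provides convergence»: with the pinned family of gen 5
  (`Parameters.countertermFamily`, `a_ρ = a·λ_ρ⁴` in the normalisation `countertermFamily_lamB_pow_four`) the
  constants above are `6c²/(aλ_ρ⁴)` — `ctFactor_mul_exp_le_pinned` states the bound in that form; the decay
  `e^{−(aλ_ρ⁴/24)(∫A²)²}` is of order one exactly when `∫A² ~ λ_ρ⁻²`, i.e. for fields «of order λ⁻¹» (docstring
  arithmetic, nothing further typed).

**Readings (declared).** (P) momentum windows as in gens 3–5. (V1) ONE VARIABLE: the estimate is proved for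
`e^{CT_ρ(A)}` and quadratic exponentials of the SAME configuration `A`; in (IV.1)/(II.78) the counterterm is a
function of `A′` while the positive Gaussian factor `e^{(1/2)(… + Σ(λ_i^t)²⟨A,(p²κ^i(p))A⟩)}` is written in the
`A`-variables, `A = T⁻¹(A′ − U(γ))` (p.341); the transfer of a quadratic bound through the pointwise-invertible
`T(γ)` (II.41)–(II.42) is position-space bookkeeping (gen 6's `…MRS93GaussianChangeOfVariables` in READING (FD)) and
is NOT typed here — so §3 is the p.352 mechanism exhibited on the p.332 factor in a common variable, not a statement
about the full integrand of (IV.1). (SG) the signs `b_ρ, c_ρ, d_ρ, e_ρ ≥ 0` are hypotheses exactly as in gen 5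
(`ctFactor_le_one`); only «a is strictly positive» is printed (Lemma III.1), and only `a_ρ > 0` drives the estimate
(the other four terms are dropped by positivity). (R) reality `Ã(−p) = conj Ã(p)` as a hypothesis where a pointwise
bound is stated, automatic (`coeff_realify_neg`) under the tree's laws.

**Honest status / what is NOT claimed.** The sentence «This starting point is clearly well defined» concerns the
WHOLE integrand of (IV.1) — eleven factors including `χ_LFR`, `G(A′, γ)` (II.45), `[K_{ρ,ρ₂}]⁻¹` (II.76), `L_{0,ρ₁}F`
(II.46)–(II.47), several typed in the tree only modulo declared functional parameters; its finiteness is NOT proved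
here (nor was it decided by gens 3–6). What is proved is the printed MECHANISM for the field `A′` at large values:
the quartic counterterm controls any quadratic instability on a finite window, which is precisely what the free
measure times the positive Gaussian factor lacks (p.332). The `γ`-side sentence («convergent at large γ thanks to
the protecting term in γ¹⁰⁰») concerns the damping factor typed in gen 5 as a nonnegative PARAMETER (READING (Y) of
`…MRS93BackgroundGaugeFixing`) and is not addressed. Nothing here instantiates MRS's expansion, nothing bears on
Bałaban's papers, nothing is continuum YM₄ on `T⁴` without infrared cutoff, nothing is Clay.
-/

noncomputable section

open MeasureTheory Finset Complex
open scoped NNReal ENNReal ComplexConjugate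

namespace Literature.MathematicalPhysics.QuantumFieldTheory.MagnenRivasseauSeneor1993

namespace QuarticDomination

open MainStatement Ansatz Counterterms

variable (S : Finset Momentum)

/-! ## §1 Calculus and positivity -/

/-- `−αt² + ct ≤ c²/(4α)` for `α > 0` (complete the square). [cite: MagnenRivasseauSeneor1993, §IV p.352 tl.28–29] -/
theorem neg_mul_sq_add_mul_le {α : ℝ} (hα : 0 < α) (c t : ℝ) : -α * t ^ 2 + c * t ≤ c ^ 2 / (4 * α) := by
  have h : 0 ≤ α * (t - c / (2 * α)) ^ 2 := by positivity
  have : α * (t - c / (2 * α)) ^ 2 = α * t ^ 2 - c * t + c ^ 2 / (4 * α) := by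
    field_simp
    ring
  linarith [this ▸ h]

/-- With `b_ρ, c_ρ, d_ρ, e_ρ ≥ 0` (READING (SG)), `CT_ρ(A) ≤ −(a_ρ/24)∫_Λ A⁴`: the operators `∫A²`, `∫A(−Δ)A`,
`∫(∂A)²` and «the F₄ term» are nonnegative (`F4_nonneg`). [cite: MagnenRivasseauSeneor1993, §III (III.1) p.347 tl.33–35; §IV p.352 tl.28–29] -/
theorem counterterm_le_neg_opA4 {cf : CountertermFamily} {ρ : ℕ} (hb : 0 ≤ cf.b ρ) (hc : 0 ≤ cf.c ρ)
    (hd : 0 ≤ cf.d ρ) (he : 0 ≤ cf.e ρ) (A : Config) :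
    counterterm S cf ρ A ≤ -(cf.a ρ / 24) * opA4 S A := by
  unfold counterterm
  have h2 := opA2_nonneg S A
  have h3 := opALapA_nonneg S A
  have h4 := opDivSq_nonneg S A
  have h5 := F4_nonneg S A
  have : 0 ≤ cf.b ρ * (opA2 S A / 2) + cf.c ρ * opALapA S A + cf.d ρ * opDivSq S A + cf.e ρ * F4 S A := by
    positivity
  linarith

/-! ## §2 «the (A′)⁴ term in CT_ρ … positive definite»: domination of every quadratic exponential -/

/-- **Gaussian-beating decay of the counterterm factor:** for a real configuration on a symmetric window and `a_ρ ≥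
0`, `e^{CT_ρ(A)} ≤ e^{−(a_ρ/24)(∫_Λ A²)²}` (gen 5's `(∫A²)² ≤ ∫A⁴`).
[cite: MagnenRivasseauSeneor1993, §IV p.352 tl.28–29; §III (III.1) p.347] -/
theorem ctFactor_le_exp_neg_sq {S : Finset Momentum} (hS : ∀ p ∈ S, p.neg ∈ S) {cf : CountertermFamily} {ρ : ℕ}
    (ha : 0 ≤ cf.a ρ) (hb : 0 ≤ cf.b ρ) (hc : 0 ≤ cf.c ρ) (hd : 0 ≤ cf.d ρ) (he : 0 ≤ cf.e ρ) {A : Config}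
    (hA : ∀ p ∈ S, ∀ μ a, coeff A p.neg μ a = conj (coeff A p μ a)) :
    ctFactor S cf ρ A ≤ Real.exp (-(cf.a ρ / 24) * opA2 S A ^ 2) := by
  have h1 := counterterm_le_neg_opA4 S hb hc hd he A
  have h2 := opA2_sq_le_opA4 hS hA
  refine Real.exp_le_exp.mpr ?_
  have : 0 ≤ cf.a ρ / 24 := by positivity
  nlinarith

/-- **THE QUARTIC COUNTERTERM DOMINATES ANY MULTIPLE OF `∫_Λ A²`:** for a real configuration on a symmetric window,
`a_ρ > 0` and `b_ρ, c_ρ, d_ρ, e_ρ ≥ 0`, `CT_ρ(A) + c∫_Λ A² ≤ 6c²/a_ρ` for every real `c`.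
[cite: MagnenRivasseauSeneor1993, §IV p.352 tl.28–29; §III (III.1) p.347, Lemma III.1 p.348 tl.7–8] -/
theorem counterterm_add_mul_opA2_le {S : Finset Momentum} (hS : ∀ p ∈ S, p.neg ∈ S) {cf : CountertermFamily}
    {ρ : ℕ} (ha : 0 < cf.a ρ) (hb : 0 ≤ cf.b ρ) (hc : 0 ≤ cf.c ρ) (hd : 0 ≤ cf.d ρ) (he : 0 ≤ cf.e ρ) {A : Config}
    (hA : ∀ p ∈ S, ∀ μ a, coeff A p.neg μ a = conj (coeff A p μ a)) (c : ℝ) :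
    counterterm S cf ρ A + c * opA2 S A ≤ 6 * c ^ 2 / cf.a ρ := by
  have h1 := counterterm_le_neg_opA4 S hb hc hd he A
  have h2 := opA2_sq_le_opA4 hS hA
  have h3 := neg_mul_sq_add_mul_le (α := cf.a ρ / 24) (by positivity) c (opA2 S A)
  have h4 : c ^ 2 / (4 * (cf.a ρ / 24)) = 6 * c ^ 2 / cf.a ρ := by
    field_simp
    ring
  have h5 : -(cf.a ρ / 24) * opA4 S A ≤ -(cf.a ρ / 24) * opA2 S A ^ 2 := by
    have : 0 ≤ cf.a ρ / 24 := by positivity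
    nlinarith
  linarith

/-- Exponentiated: `e^{CT_ρ(A)}·e^{c∫_Λ A²} ≤ e^{6c²/a_ρ}` — a quadratic instability of ANY strength `c` is bounded
once the quartic counterterm is present. [cite: MagnenRivasseauSeneor1993, §IV p.352 tl.28–29; §III (III.1) p.347] -/
theorem ctFactor_mul_exp_le {S : Finset Momentum} (hS : ∀ p ∈ S, p.neg ∈ S) {cf : CountertermFamily} {ρ : ℕ}
    (ha : 0 < cf.a ρ) (hb : 0 ≤ cf.b ρ) (hc : 0 ≤ cf.c ρ) (hd : 0 ≤ cf.d ρ) (he : 0 ≤ cf.e ρ) {A : Config}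
    (hA : ∀ p ∈ S, ∀ μ a, coeff A p.neg μ a = conj (coeff A p μ a)) (c : ℝ) :
    ctFactor S cf ρ A * Real.exp (c * opA2 S A) ≤ Real.exp (6 * c ^ 2 / cf.a ρ) := by
  rw [ctFactor, ← Real.exp_add]
  exact Real.exp_le_exp.mpr (counterterm_add_mul_opA2_le hS ha hb hc hd he hA c)

/-- **Any factor of Gaussian growth is tamed:** if `g(A) ≤ c∫_Λ A² + c'` then `e^{CT_ρ(A)}·e^{g(A)} ≤ e^{6c²/a_ρ + c'}`
(real configuration, symmetric window, `a_ρ > 0`, `b_ρ, c_ρ, d_ρ, e_ρ ≥ 0`) — the interface through which any further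
factor of (IV.1) with at most quadratic growth in the field would enter.
[cite: MagnenRivasseauSeneor1993, §IV p.352 tl.28–29; §III (III.1) p.347] -/
theorem ctFactor_mul_exp_le_of_growth {S : Finset Momentum} (hS : ∀ p ∈ S, p.neg ∈ S) {cf : CountertermFamily}
    {ρ : ℕ} (ha : 0 < cf.a ρ) (hb : 0 ≤ cf.b ρ) (hc : 0 ≤ cf.c ρ) (hd : 0 ≤ cf.d ρ) (he : 0 ≤ cf.e ρ) {A : Config}
    (hA : ∀ p ∈ S, ∀ μ a, coeff A p.neg μ a = conj (coeff A p μ a)) {g : Config → ℝ} {c c' : ℝ}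
    (hg : g A ≤ c * opA2 S A + c') :
    ctFactor S cf ρ A * Real.exp (g A) ≤ Real.exp (6 * c ^ 2 / cf.a ρ + c') := by
  have h := counterterm_add_mul_opA2_le hS ha hb hc hd he hA c
  rw [ctFactor, ← Real.exp_add]
  exact Real.exp_le_exp.mpr (by linarith)

/-- A symbol bounded by `W` on the window gives a form bounded by `W·∫_Λ A²`: `⟨A, w(p)A⟩ ≤ W·⟨A, A⟩`.
[cite: MagnenRivasseauSeneor1993, §II.A p.328 tl.37–41; §IV p.352 tl.26–27 «finite volume and ultraviolet cutoff»] -/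
theorem quadForm_le_mul_opA2 {w : Momentum → ℝ} {W : ℝ} (hw : ∀ p ∈ S, w p ≤ W) (A : Config) :
    quadForm S w A ≤ W * opA2 S A := by
  have hn : ∀ p, 0 ≤ ∑ μ, ∑ a, normSq (coeff A p μ a) := fun p =>
    Finset.sum_nonneg fun _ _ => Finset.sum_nonneg fun _ _ => normSq_nonneg _
  have key : ∑ p ∈ S, w p * ∑ μ, ∑ a, normSq (coeff A p μ a) ≤ ∑ p ∈ S, W * ∑ μ, ∑ a, normSq (coeff A p μ a) :=
    Finset.sum_le_sum fun p hp => mul_le_mul_of_nonneg_right (hw p hp) (hn p)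
  rw [← Finset.mul_sum] at key
  rw [opA2_eq_quadForm]
  unfold quadForm
  simp only [one_mul]
  linarith

/-- A crude bound of a symbol on the (finite) window: `Σ_{q∈S}|w(q)|`.
[cite: MagnenRivasseauSeneor1993, §IV p.352 tl.26–27 «finite volume and ultraviolet cutoff on each of the fields»] -/
def symBound (w : Momentum → ℝ) : ℝ := ∑ q ∈ S, |w q|

/-- `w(p) ≤ symBound` on the window. [cite: MagnenRivasseauSeneor1993, §IV p.352 tl.26–27] -/
theorem le_symBound (w : Momentum → ℝ) {p : Momentum} (hp : p ∈ S) : w p ≤ symBound S w :=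
  (le_abs_self _).trans (Finset.single_le_sum (f := fun q => |w q|) (fun q _ => abs_nonneg (w q)) hp)

/-- `0 ≤ symBound`. [cite: MagnenRivasseauSeneor1993, §IV p.352 tl.26–27] -/
theorem symBound_nonneg (w : Momentum → ℝ) : 0 ≤ symBound S w := Finset.sum_nonneg fun q _ => abs_nonneg (w q)

/-- **`e^{CT_ρ(A)}·e^{⟨A, w(p)A⟩} ≤ e^{6W²/a_ρ}`** for every symbol `w ≤ W` on the window (real configuration, symmetric
window, `a_ρ > 0`, `b_ρ, c_ρ, d_ρ, e_ρ ≥ 0`). [cite: MagnenRivasseauSeneor1993, §IV p.352 tl.28–29; §III (III.1) p.347] -/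
theorem ctFactor_mul_exp_quadForm_le {S : Finset Momentum} (hS : ∀ p ∈ S, p.neg ∈ S) {cf : CountertermFamily}
    {ρ : ℕ} (ha : 0 < cf.a ρ) (hb : 0 ≤ cf.b ρ) (hc : 0 ≤ cf.c ρ) (hd : 0 ≤ cf.d ρ) (he : 0 ≤ cf.e ρ) {A : Config}
    (hA : ∀ p ∈ S, ∀ μ a, coeff A p.neg μ a = conj (coeff A p μ a)) {w : Momentum → ℝ} {W : ℝ}
    (hw : ∀ p ∈ S, w p ≤ W) :
    ctFactor S cf ρ A * Real.exp (quadForm S w A) ≤ Real.exp (6 * W ^ 2 / cf.a ρ) := by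
  refine le_trans ?_ (ctFactor_mul_exp_le hS ha hb hc hd he hA W)
  exact mul_le_mul_of_nonneg_left (Real.exp_le_exp.mpr (quadForm_le_mul_opA2 S hw A)) (ctFactor_pos S cf ρ A).le

/-- The same on the realified coordinates `realify modeIm X` on which the tree's Gaussian laws live (reality is
automatic there, `coeff_realify_neg`). [cite: MagnenRivasseauSeneor1993, §IV p.352 tl.28–29; §II.A p.328 tl.12–17] -/
theorem ctFactor_mul_exp_quadForm_le_realify {S : Finset Momentum} (hS : ∀ p ∈ S, p.neg ∈ S)
    {cf : CountertermFamily} {ρ : ℕ} (ha : 0 < cf.a ρ) (hb : 0 ≤ cf.b ρ) (hc : 0 ≤ cf.c ρ) (hd : 0 ≤ cf.d ρ)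
    (he : 0 ≤ cf.e ρ) {w : Momentum → ℝ} {W : ℝ} (hw : ∀ p ∈ S, w p ≤ W) (X : Config) :
    ctFactor S cf ρ (realify modeIm X) * Real.exp (quadForm S w (realify modeIm X)) ≤
      Real.exp (6 * W ^ 2 / cf.a ρ) :=
  ctFactor_mul_exp_quadForm_le hS ha hb hc hd he (fun p _ μ a => coeff_realify_neg X p μ a) hw

/-! ## §3 The contrast with p.332 «This formula is still formal» made a theorem -/

/-- `(1/2)Σ_{i≤ρ₁}(λ_i^t)²⟨A, p²κ^i(p)A⟩ ≤ (W/2)·∫_Λ A²` with `W = symBound` of the symbol `C₀⁻¹(p)` of (II.16)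
(`quadSlices_eq_invC0`). [cite: MagnenRivasseauSeneor1993, (II.16)–(II.18) p.332; §IV p.352 tl.26–29] -/
theorem half_quadSlices_le (par : Parameters) (ρ₁ : ℕ) (A : Config) :
    (1 / 2) * quadSlices S par ρ₁ A ≤ (symBound S (fun p => par.invC0 ρ₁ p.norm) / 2) * opA2 S A := by
  rw [quadSlices_eq_invC0]
  have := quadForm_le_mul_opA2 S (w := fun p => par.invC0 ρ₁ p.norm)
    (W := symBound S (fun p => par.invC0 ρ₁ p.norm)) (fun p hp => le_symBound S (fun p => par.invC0 ρ₁ p.norm) hp) A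
  linarith

/-- **WITH the counterterm, the positive Gaussian factor of (II.18)/(II.78) is dominated:**
`e^{CT_ρ(A)}·e^{+(1/2)Σ_{i≤ρ₁}(λ_i^t)²⟨A, p²κ^i(p)A⟩} ≤ e^{6(W/2)²/a_ρ}` (real configuration, symmetric window, `a_ρ > 0`,
`b_ρ, c_ρ, d_ρ, e_ρ ≥ 0`; READING (V1): one common variable).
[cite: MagnenRivasseauSeneor1993, §IV p.352 tl.28–29; (II.18) p.332 tl.16–26; §III (III.1) p.347] -/
theorem ctFactor_mul_exp_half_quadSlices_le (par : Parameters) {S : Finset Momentum} (hS : ∀ p ∈ S, p.neg ∈ S)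
    {cf : CountertermFamily} {ρ : ℕ} (ha : 0 < cf.a ρ) (hb : 0 ≤ cf.b ρ) (hc : 0 ≤ cf.c ρ) (hd : 0 ≤ cf.d ρ)
    (he : 0 ≤ cf.e ρ) {A : Config} (hA : ∀ p ∈ S, ∀ μ a, coeff A p.neg μ a = conj (coeff A p μ a)) (ρ₁ : ℕ) :
    ctFactor S cf ρ A * Real.exp ((1 / 2) * quadSlices S par ρ₁ A) ≤
      Real.exp (6 * (symBound S (fun p => par.invC0 ρ₁ p.norm) / 2) ^ 2 / cf.a ρ) := by
  refine le_trans ?_ (ctFactor_mul_exp_le hS ha hb hc hd he hA _)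
  exact mul_le_mul_of_nonneg_left (Real.exp_le_exp.mpr (half_quadSlices_le S par ρ₁ A)) (ctFactor_pos S cf ρ A).le

/-- A continuous `e^{CT_ρ}·e^{g}` that is bounded on real configurations is integrable against every realified
Gaussian field law of the tree (`gaussianFieldLaw modeIm v` = the push-forward of independent Gaussian modes under
`realify`). [cite: MagnenRivasseauSeneor1993, (II.17)–(II.18) p.332; §IV p.352 tl.26–29] -/
theorem integrable_ctFactor_mul_exp_gaussianFieldLaw {S : Finset Momentum} {cf : CountertermFamily} {ρ : ℕ}
    {g : Config → ℝ} (hg : Continuous g) {C : ℝ}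
    (hbound : ∀ A : Config, (∀ p ∈ S, ∀ μ a, coeff A p.neg μ a = conj (coeff A p μ a)) →
      ctFactor S cf ρ A * Real.exp (g A) ≤ C) (v : Mode → ℝ≥0) :
    Integrable (fun A => ctFactor S cf ρ A * Real.exp (g A)) (gaussianFieldLaw modeIm v) := by
  have hcont : Continuous fun A : Config => ctFactor S cf ρ A * Real.exp (g A) :=
    (continuous_ctFactor S cf ρ).mul (Real.continuous_exp.comp hg)
  unfold gaussianFieldLaw
  rw [integrable_map_measure hcont.measurable.aestronglyMeasurable (measurable_realify modeIm).aemeasurable]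
  refine Integrable.of_bound (C := C)
    (hcont.measurable.comp (measurable_realify modeIm)).aestronglyMeasurable (Filter.Eventually.of_forall fun X => ?_)
  simp only [Function.comp_apply, Real.norm_eq_abs]
  rw [abs_of_pos (mul_pos (ctFactor_pos S cf ρ _) (Real.exp_pos _))]
  exact hbound _ (fun p _ μ a => coeff_realify_neg X p μ a)

/-- **p.352 AGAINST p.332, KERNEL-CHECKED:** on every window symmetric under `p ↦ −p`, for every `ρ, ρ₁` and every
counterterm family with `a_ρ > 0`, `b_ρ, c_ρ, d_ρ, e_ρ ≥ 0`, the function `A ↦ e^{CT_ρ(A)}·e^{(1/2)Σ_{i≤ρ₁}(λ_i^t)²⟨A,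
p²κ^i(p)A⟩}` IS `dμ_{0,ρ₁}`-integrable — whereas the second factor ALONE is not
(`MainStatement.not_integrable_exp_half_quadSlices_muZero`, p.332 tl.24–26 «still formal»): «the (A′)⁴ term in CT_ρ
… positive definite» is what «provides convergence» for large fields.
[cite: MagnenRivasseauSeneor1993, §IV p.352 tl.26–31; (II.18) p.332 tl.16–26; §III (III.1) p.347, Lemma III.1 p.348] -/
theorem integrable_ctFactor_mul_exp_half_quadSlices_muZero (par : Parameters) {S : Finset Momentum}
    (hS : ∀ p ∈ S, p.neg ∈ S) {cf : CountertermFamily} {ρ : ℕ} (ha : 0 < cf.a ρ) (hb : 0 ≤ cf.b ρ)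
    (hc : 0 ≤ cf.c ρ) (hd : 0 ≤ cf.d ρ) (he : 0 ≤ cf.e ρ) (ρ₁ : ℕ) :
    Integrable (fun A => ctFactor S cf ρ A * Real.exp ((1 / 2) * quadSlices S par ρ₁ A)) (muZero par ρ₁) :=
  integrable_ctFactor_mul_exp_gaussianFieldLaw ((continuous_quadSlices S par ρ₁).const_mul _)
    (fun _ hA => ctFactor_mul_exp_half_quadSlices_le par hS ha hb hc hd he hA ρ₁) _

/-- The same against the twelve-component reference measure `dμ_{0,ρ₁}(A′)dμ_{C₀,ρ₁}(A′₀)` of (II.44)–(II.46) on which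
`e^{CT_ρ(A′)}` actually sits in (II.78)/(IV.1), for any symbol `w ≤ W` on the window:
`A′ ↦ e^{CT_ρ(A′)}·e^{⟨A′, w(p)A′⟩}` is integrable. [cite: MagnenRivasseauSeneor1993, §IV (IV.1) p.352, p.352 tl.26–29; (II.44)–(II.46) pp.341–342; (II.78) p.347] -/
theorem integrable_ctFactor_mul_exp_quadForm_muZeroPrime (par : Parameters) {S : Finset Momentum}
    (hS : ∀ p ∈ S, p.neg ∈ S) {cf : CountertermFamily} {ρ : ℕ} (ha : 0 < cf.a ρ) (hb : 0 ≤ cf.b ρ)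
    (hc : 0 ≤ cf.c ρ) (hd : 0 ≤ cf.d ρ) (he : 0 ≤ cf.e ρ) {w : Momentum → ℝ} {W : ℝ} (hw : ∀ p ∈ S, w p ≤ W)
    (ρ₁ : ℕ) :
    Integrable (fun A => ctFactor S cf ρ A * Real.exp (quadForm S w A)) (muZeroPrime par ρ₁) :=
  integrable_ctFactor_mul_exp_gaussianFieldLaw (continuous_quadForm S w)
    (fun _ hA => ctFactor_mul_exp_quadForm_le hS ha hb hc hd he hA hw) _

/-! ## §3b «It is only the combination of this term with the axial gauge positivity which does this» — the
full third factor of (II.78)/(IV.1) times `e^{CT_ρ}` is a FINITE density for `dμ_{0,ρ₁}` (READING (V1)) -/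

/-- With the axial-gauge positivity «both pieces in (II.9) are obviously positive» (gen 3's
`ymFactor_le_exp_half_quadSlices`: `e^{(1/2)(−F²_sp(A) − ⟨A,p₀²A⟩ + Σ(λ_i^t)²⟨A,p²κ^iA⟩)} ≤ e^{(1/2)Σ(λ_i^t)²⟨A,p²κ^iA⟩}`)
and the quartic counterterm: `e^{CT_ρ(A)}·e^{(1/2)(−F²_sp(A) − ⟨A,p₀²A⟩ + Σ_{i≤ρ₁}(λ_i^t)²⟨A,p²κ^i(p)A⟩)} ≤ e^{6(W/2)²/a_ρ}`
(real configuration, symmetric window, `a_ρ > 0`, `b_ρ, c_ρ, d_ρ, e_ρ ≥ 0`).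
[cite: MagnenRivasseauSeneor1993, §IV p.352 tl.28–33; (II.9) p.330 tl.10; (II.18) p.332; (II.78) p.347 tl.2–7; §III (III.1) p.347] -/
theorem ctFactor_mul_ymFactor_le (par : Parameters) {S : Finset Momentum} (hS : ∀ p ∈ S, p.neg ∈ S)
    {cf : CountertermFamily} {ρ : ℕ} (ha : 0 < cf.a ρ) (hb : 0 ≤ cf.b ρ) (hc : 0 ≤ cf.c ρ) (hd : 0 ≤ cf.d ρ)
    (he : 0 ≤ cf.e ρ) {A : Config} (hA : ∀ p ∈ S, ∀ μ a, coeff A p.neg μ a = conj (coeff A p μ a)) (lam : ℝ)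
    (ρ₁ : ℕ) :
    ctFactor S cf ρ A * ymFactor S par lam ρ₁ A ≤
      Real.exp (6 * (symBound S (fun p => par.invC0 ρ₁ p.norm) / 2) ^ 2 / cf.a ρ) :=
  le_trans (mul_le_mul_of_nonneg_left (ymFactor_le_exp_half_quadSlices S par lam ρ₁ A) (ctFactor_pos S cf ρ A).le)
    (ctFactor_mul_exp_half_quadSlices_le par hS ha hb hc hd he hA ρ₁)

/-- A continuous nonnegative `f` with `e^{CT_ρ}·f` bounded on real configurations gives an integrable `e^{CT_ρ}·f`
against every realified Gaussian field law of the tree. [cite: MagnenRivasseauSeneor1993, (II.17)–(II.18) p.332; §IV p.352 tl.26–29] -/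
theorem integrable_ctFactor_mul_of_le_gaussianFieldLaw {S : Finset Momentum} {cf : CountertermFamily} {ρ : ℕ}
    {f : Config → ℝ} (hf : Continuous f) (hf0 : ∀ A, 0 ≤ f A) {C : ℝ}
    (hbound : ∀ A : Config, (∀ p ∈ S, ∀ μ a, coeff A p.neg μ a = conj (coeff A p μ a)) →
      ctFactor S cf ρ A * f A ≤ C) (v : Mode → ℝ≥0) :
    Integrable (fun A => ctFactor S cf ρ A * f A) (gaussianFieldLaw modeIm v) := by
  have hcont : Continuous fun A : Config => ctFactor S cf ρ A * f A := (continuous_ctFactor S cf ρ).mul hf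
  unfold gaussianFieldLaw
  rw [integrable_map_measure hcont.measurable.aestronglyMeasurable (measurable_realify modeIm).aemeasurable]
  refine Integrable.of_bound (C := C)
    (hcont.measurable.comp (measurable_realify modeIm)).aestronglyMeasurable (Filter.Eventually.of_forall fun X => ?_)
  simp only [Function.comp_apply, Real.norm_eq_abs]
  rw [abs_of_nonneg (mul_nonneg (ctFactor_pos S cf ρ _).le (hf0 _))]
  exact hbound _ (fun p _ μ a => coeff_realify_neg X p μ a)

/-- **THE THIRD FACTOR OF (II.78)/(IV.1) TIMES `e^{CT_ρ}` IS `dμ_{0,ρ₁}`-INTEGRABLE** on every symmetric window, for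
every coupling inside `F_sp`, every `ρ, ρ₁`, every counterterm family with `a_ρ > 0`, `b_ρ, c_ρ, d_ρ, e_ρ ≥ 0`:
`A ↦ e^{CT_ρ(A)}·e^{(1/2)(−F²_sp(A) − ⟨A,p₀²A⟩ + Σ_{i≤ρ₁}(λ_i^t)²⟨A,p²κ^i(p)A⟩)} ∈ L¹(dμ_{0,ρ₁})` — «the combination of this term
with the axial gauge positivity» (READING (V1): one common variable).
[cite: MagnenRivasseauSeneor1993, §IV p.352 tl.26–33; (II.18) p.332 tl.16–26; (II.78) p.347 tl.2–7; §III (III.1) p.347, Lemma III.1 p.348] -/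
theorem integrable_ctFactor_mul_ymFactor_muZero (par : Parameters) {S : Finset Momentum} (hS : ∀ p ∈ S, p.neg ∈ S)
    {cf : CountertermFamily} {ρ : ℕ} (ha : 0 < cf.a ρ) (hb : 0 ≤ cf.b ρ) (hc : 0 ≤ cf.c ρ) (hd : 0 ≤ cf.d ρ)
    (he : 0 ≤ cf.e ρ) (lam : ℝ) (ρ₁ : ℕ) :
    Integrable (fun A => ctFactor S cf ρ A * ymFactor S par lam ρ₁ A) (muZero par ρ₁) :=
  integrable_ctFactor_mul_of_le_gaussianFieldLaw (continuous_ymFactor S par lam ρ₁)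
    (fun A => (ymFactor_pos S par lam ρ₁ A).le)
    (fun _ hA => ctFactor_mul_ymFactor_le par hS ha hb hc hd he hA lam ρ₁) _

/-- Hence **`dμ_{0,ρ₁}(A)·e^{CT_ρ(A)}·e^{(1/2)(−F²_sp − ⟨A,p₀²A⟩ + Σ(λ_i^t)²⟨A,p²κ^iA⟩)}` IS A FINITE MEASURE on the cut-off
configurations of every symmetric window** — the formula (II.18), «still formal» by itself (p.332; gen 3's
`not_integrable_exp_half_quadSlices_muZero`), stops being formal once the counterterm factor of (II.78) with `a_ρ > 0`
multiplies it (READING (V1); the remaining factors of (IV.1) untouched).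
[cite: MagnenRivasseauSeneor1993, §IV p.352 tl.26–33; (II.18) p.332 tl.16–26; (II.78) p.347; §III (III.1)–(III.2) pp.347–348] -/
theorem isFiniteMeasure_muZero_withDensity_ctFactor_mul_ymFactor (par : Parameters) {S : Finset Momentum}
    (hS : ∀ p ∈ S, p.neg ∈ S) {cf : CountertermFamily} {ρ : ℕ} (ha : 0 < cf.a ρ) (hb : 0 ≤ cf.b ρ)
    (hc : 0 ≤ cf.c ρ) (hd : 0 ≤ cf.d ρ) (he : 0 ≤ cf.e ρ) (lam : ℝ) (ρ₁ : ℕ) :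
    IsFiniteMeasure ((muZero par ρ₁).withDensity fun A =>
      ENNReal.ofReal (ctFactor S cf ρ A * ymFactor S par lam ρ₁ A)) :=
  isFiniteMeasure_withDensity_ofReal
    (integrable_ctFactor_mul_ymFactor_muZero par hS ha hb hc hd he lam ρ₁).hasFiniteIntegral

/-! ## §4 «only for fields of order λ⁻¹ that the (A′)⁴ term provides convergence»: the constants with `a_ρ = a·λ_ρ⁴` -/

/-- With gen 5's pinned family (`a_ρ := a ρ` a binder sequence; by (III.2) `a_ρ ≅ a·λ_ρ⁴`) and a leading coefficient of
the printed shape `a ρ = a₀·λ_ρ⁴`, `a₀ > 0`, `λ_ρ⁴ = (λ_ρ²)²` (`countertermFamily_lamB_pow_four`): the domination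
constant is `6c²/(a₀λ_ρ⁴)` — it degenerates as `λ_ρ → 0`, the printed «this term alone does not confine the field in
the true perturbative region (A′ ≪ λ⁻¹)»; the decay `e^{−(a₀λ_ρ⁴/24)(∫A²)²}` of `ctFactor_le_exp_neg_sq` is of order one
exactly when `∫_Λ A² ~ λ_ρ⁻²`, i.e. for fields «of order λ⁻¹».
[cite: MagnenRivasseauSeneor1993, §IV p.352 tl.30–32; Lemma III.1 (III.2) p.348 tl.5–8; (II.11) p.330] -/
theorem ctFactor_mul_exp_le_pinned (par : Parameters) {S : Finset Momentum} (hS : ∀ p ∈ S, p.neg ∈ S)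
    {a b c d e : ℕ → ℝ} {ρ : ℕ} {a₀ : ℝ} (ha₀ : 0 < a₀) (hlam : 0 < par.bareCoupling ρ)
    (haρ : a ρ = a₀ * par.bareCoupling ρ ^ 2) (hb : 0 ≤ b ρ) (hc : 0 ≤ c ρ) (hd : 0 ≤ d ρ) (he : 0 ≤ e ρ)
    {A : Config} (hA : ∀ p ∈ S, ∀ μ a, coeff A p.neg μ a = conj (coeff A p μ a)) (c' : ℝ) :
    ctFactor S (par.countertermFamily a b c d e) ρ A * Real.exp (c' * opA2 S A) ≤
      Real.exp (6 * c' ^ 2 / (a₀ * par.bareCoupling ρ ^ 2)) := by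
  have ha : 0 < (par.countertermFamily a b c d e).a ρ := by
    show 0 < a ρ
    rw [haρ]
    positivity
  have h := ctFactor_mul_exp_le hS ha hb hc hd he hA c'
  have : (par.countertermFamily a b c d e).a ρ = a₀ * par.bareCoupling ρ ^ 2 := haρ
  rw [this] at h
  exact h

end QuarticDomination

end Literature.MathematicalPhysics.QuantumFieldTheory.MagnenRivasseauSeneor1993
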